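import Literature.MathematicalPhysics.QuantumLattice.GrassmannWeightedTruncatedBoundDB
import Literature.MathematicalPhysics.QuantumLattice.GrassmannWeightedCumulantBound
import Literature.MathematicalPhysics.QuantumLattice.GrassmannVacuumBoundDB
import HarnessLib

/-!
# The decay-weighted cumulant bounds for DETERMINANT-BOUNDED covariances
# (twin of `GrassmannWeightedCumulantBound` under `IsGramBoundedR`)

Topic `MathematicalPhysics/QuantumLattice`; continuation of `GrassmannWeightedTruncatedBoundDB`.  The decay-weighted `L¹–L^∞` bound
for the kernels of the cumulants `𝓔ᵀ_C(V; n)` (Benfatto–Giuliani–Mastropietro 2006, (2.13)–(2.14) with (2.77)–(2.80) and the moment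
bookkeeping of §3 (3.2)–(3.8)) re-run VERBATIM under the replica-stable hypothesis `IsGramBoundedR C κ` (de Siqueira Pedra–Salmhofer 2008:
the determinant bound of a chronological propagator is replica-stable, `IsDetBoundedR.isGramBoundedR`, and has no temperature-uniform
Gram form): the proofs pass to the replica covariance `C.submatrix Prod.snd Prod.snd` on `Fin n × Γ`, Gram-bounded by
`IsGramBoundedR.submatrix`, and call `sum_wt_norm_kernel_ursellOf_kernelVertex_le_of_gramBounded` /
`kernel_ursellOf_kernelVertex_eq_zero_of_lt_of_gramBounded` where the Gram-form file calls their Gram twins.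

* **`sum_wt_norm_kernel_cumulantOf_le_of_gramBounded`** — `Σ_{W : W_i = w} wt(W) ‖kernel_r 𝓔ᵀ_C(V; n)(W)‖ ≤ n · Σ_δ [r + 2(n-1) ≤ N_δ] cumulantBound(δ)`
  with `wt`-weighted anchored norms `N(m')` and `wt`-weighted row / column sums `α`;
* **`sum_wt_norm_kernel_cumulantOf_le_pow_of_gramBounded`** — the standard choice of `λ_δ`: `≤ n!·ρ^{-r} κ^{-2(n-1)} α^{n-1} eⁿ·‖V‖_{h,wt}ⁿ`.

Used by the scale-`0` first-moment bound (E4)₀ of the K3 engine of the cell gate-hubbard-kl.  Everything is proved; no definition,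
no named fact.

## Sources

G. Benfatto, A. Giuliani, V. Mastropietro, Ann. Henri Poincaré 7 (2006) 809–898, (2.13)–(2.14), (2.66)–(2.80), §3 (3.2)–(3.8)
[`BenfattoGiulianiMastropietro2006`]; W. de Siqueira Pedra, M. Salmhofer, Comm. Math. Phys. 282 (2008) 797–818, Thm 1.3, Thm 2.4
[`PedraSalmhofer2008`]; G. Gentile, V. Mastropietro, Phys. Rep. 352 (2001) 273–437, §4 [`GentileMastropietro2001`].
-/

noncomputable section

namespace Literature.MathematicalPhysics.QuantumLattice

open GrassmannAlgebra Finset Literature.Probability.LatticeModels Literature.Probability.LatticeModels.BattleFederbush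
open scoped InnerProductSpace

universe u

variable {𝕜 : Type*} [RCLike 𝕜] {Γ : Type u} [Fintype Γ] [DecidableEq Γ] {n : ℕ} {wt : Finset Γ → ℝ} (C : Matrix Γ Γ 𝕜)

/-- (Twin of `sum_wt_norm_kernel_cumulantOf_le` under `IsGramBoundedR`.) **The decay-weighted `L¹–L^∞` bound for the kernels of `𝓔ᵀ_C(V; n)`, determinant-bounded covariance** (Benfatto–Giuliani–Mastropietro 2006,
(2.13)–(2.14) with (2.77)–(2.80) and §3 (3.2)–(3.8)): for a tree weight `wt`, `V = Σ_{m' ∈ degs} Σ_Y K_{m'}(Y) ψ(Y)` with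
`wt`-weighted anchored `L¹` norms `≤ N(m')`, a covariance that is replica-stably Gram-BOUNDED with constant `κ` (`IsGramBoundedR`) and
one-copy row and column sums of `‖C(X,Y)‖ wt{X,Y}` at most `α`, and any positive `λ_δ`: one output label pinned and the
others summed against the weight of the output label set, `Σ_{W : W_i = w} wt(W) ‖kernel_r 𝓔ᵀ_C(V; n) (W)‖ ≤ n · Σ_δ cumulantBound(δ)`.
[cite: BenfattoGiulianiMastropietro2006, (2.13)-(2.14), (2.77)-(2.80) and §3 (3.2)-(3.8)] -/
theorem sum_wt_norm_kernel_cumulantOf_le_of_gramBounded (hwt : IsTreeWeight wt) {κ : ℝ} (hκ : 0 ≤ κ) (hGB : IsGramBoundedR C κ)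
    (degs : Finset ℕ) (K : (m' : ℕ) → (Fin (2 * m') → Γ) → 𝕜) (N : ℕ → ℝ) (hN0 : ∀ m', 0 ≤ N m')
    (hN : ∀ m' (j : Fin (2 * m')) (w : Γ), ∑ Y ∈ univ.filter (fun Y : Fin (2 * m') → Γ => Y j = w), ‖K m' Y‖ * wt (univ.image Y) ≤ N m')
    {α : ℝ} (hα : 0 ≤ α) (hrow : ∀ X, ∑ Y, ‖C X Y‖ * wt {X, Y} ≤ α) (hcol : ∀ Y, ∑ X, ‖C X Y‖ * wt {X, Y} ≤ α)
    (lam : (Fin n → ℕ) → ℝ) (hlam : ∀ δ, 0 < lam δ) (hn : 0 < n) {r : ℕ} (i : Fin r) (w : Γ) :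
    ∑ W ∈ univ.filter (fun W : Fin r → Γ => W i = w), wt (univ.image W) *
        ‖kernel 𝕜 ((cumulantOf (fun k => evenGaussConv 𝕜 C (vertexOf 𝕜 degs K ^ k)) n : evenPart 𝕜 Γ) : GrassmannAlgebra 𝕜 Γ) r W‖ ≤
      (n : ℝ) * ∑ δ ∈ Fintype.piFinset (fun _ : Fin n => degs),
        (if r + 2 * (n - 1) ≤ ∑ a, 2 * δ a then cumulantBound n κ α (lam δ) N r δ else 0) := by
  set C' : Matrix (Fin n × Γ) (Fin n × Γ) 𝕜 := C.submatrix Prod.snd Prod.snd with hC'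
  have huniv : (univ : Finset (Fin n)).Nonempty := ⟨⟨0, hn⟩, mem_univ _⟩
  -- the replica weight
  have hwt' : IsTreeWeight (fun S' : Finset (Fin n × Γ) => wt (S'.image Prod.snd)) := hwt.comap Prod.snd
  -- the degree-`δ` replica families
  set U : (Fin n → ℕ) → evenPart 𝕜 (Fin n × Γ) := fun δ => ursellOf (convMoment 𝕜 C'
    (kernelVertex 𝕜 (deg := fun b : Fin n => 2 * δ b) (fun b => even_two_mul (δ b)) fun b => replicaKer 𝕜 (K (δ b)) b)) univ with hU
  -- replicas, collapse and multilinearity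
  have hcum : ((cumulantOf (fun k => evenGaussConv 𝕜 C (vertexOf 𝕜 degs K ^ k)) n : evenPart 𝕜 Γ) : GrassmannAlgebra 𝕜 Γ) =
      ∑ δ ∈ Fintype.piFinset (fun _ : Fin n => degs), collapse 𝕜 (Prod.snd : Fin n × Γ → Γ) (U δ : GrassmannAlgebra 𝕜 (Fin n × Γ)) := by
    have h1 := collapseEven_ursellOf_convMoment_eq_cumulantOf 𝕜 (Prod.snd : Fin n × Γ → Γ) C (replicaVertex 𝕜 degs K)
      (vertexOf 𝕜 degs K) (collapseEven_replicaVertex 𝕜 degs K) huniv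
    rw [card_univ, Fintype.card_fin] at h1
    rw [← h1, coe_collapseEven]
    have h2 : ursellOf (convMoment 𝕜 C' (replicaVertex 𝕜 degs K)) univ = ∑ δ ∈ Fintype.piFinset (fun _ : Fin n => degs), U δ := by
      have h := ursellOf_convMoment_eq_sum_piFinset 𝕜 C' (Prod.fst : Fin n × Γ → Fin n) (fun _ : Fin n => degs)
        (fun a m' => kernelVertex 𝕜 (deg := fun _ : Fin n => 2 * m') (fun _ => even_two_mul m') (fun b => replicaKer 𝕜 (K m') b) a)
        (fun a m' => coe_kernelVertex_replicaKer_mem 𝕜 m' (K m') a) ⟨0, hn⟩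
      exact h
    rw [← hC', h2, AddSubmonoidClass.coe_finsetSum, map_sum]
  -- the weighted bound per degree assignment and pinned copy
  have hδ : ∀ (δ : Fin n → ℕ) (b : Fin n), ∑ W' ∈ univ.filter (fun W' : Fin r → Fin n × Γ => W' i = (b, w)),
      wt ((univ.image W').image Prod.snd) * ‖kernel 𝕜 (U δ : GrassmannAlgebra 𝕜 (Fin n × Γ)) r W'‖ ≤
        if r + 2 * (n - 1) ≤ ∑ a, 2 * δ a then cumulantBound n κ α (lam δ) N r δ else 0 := by
    intro δ b
    have hGB' : IsGramBounded C' κ := by rw [hC']; exact (hGB.submatrix Prod.snd).isGramBounded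
    have hKs : ∀ (v : Fin n) (Yv : Fin (2 * δ v) → Fin n × Γ), replicaKer 𝕜 (K (δ v)) v Yv ≠ 0 → ∀ j, (Yv j).1 = v :=
      fun v Yv h j => replicaKer_support 𝕜 (K (δ v)) v Yv h j
    split_ifs with hle
    · exact sum_wt_norm_kernel_ursellOf_kernelVertex_le_of_gramBounded C' (Prod.fst : Fin n × Γ → Fin n)
        (fun b => replicaKer 𝕜 (K (δ b)) b) hwt' hκ hGB'
        (fun b => even_two_mul (δ b)) hKs (fun u => N (δ u)) (fun u => hN0 _)
        (fun u j a' => sum_filter_wt_norm_replicaKer_le hwt (K (δ u)) u (hN (δ u)) j a') hα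
        (fun ℓ X' => sum_wt_norm_typeRestrict_submatrix_le C hα hrow ℓ X') (fun ℓ Y' => sum_wt_norm_typeRestrict_submatrix_le' C hα hcol ℓ Y')
        (hlam δ) i (b, w)
    · refine le_of_eq (sum_eq_zero fun W' _ => ?_)
      rw [hU]
      dsimp only
      rw [kernel_ursellOf_kernelVertex_eq_zero_of_lt_of_gramBounded C' (Prod.fst : Fin n × Γ → Fin n)
        (fun b => replicaKer 𝕜 (K (δ b)) b) hκ hGB'
        (fun b => even_two_mul (δ b)) hKs ⟨0, hn⟩ (not_le.1 hle) W', norm_zero, mul_zero]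
  -- assemble
  calc ∑ W ∈ univ.filter (fun W : Fin r → Γ => W i = w), wt (univ.image W) *
          ‖kernel 𝕜 ((cumulantOf (fun k => evenGaussConv 𝕜 C (vertexOf 𝕜 degs K ^ k)) n : evenPart 𝕜 Γ) : GrassmannAlgebra 𝕜 Γ) r W‖
      ≤ ∑ W ∈ univ.filter (fun W : Fin r → Γ => W i = w), ∑ δ ∈ Fintype.piFinset (fun _ : Fin n => degs),
          wt (univ.image W) * ‖kernel 𝕜 (collapse 𝕜 (Prod.snd : Fin n × Γ → Γ) (U δ : GrassmannAlgebra 𝕜 (Fin n × Γ))) r W‖ := by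
        refine sum_le_sum fun W _ => ?_
        rw [hcum, kernel_sum, ← mul_sum]
        exact mul_le_mul_of_nonneg_left (norm_sum_le _ _) (hwt.nonneg _)
    _ = ∑ δ ∈ Fintype.piFinset (fun _ : Fin n => degs), ∑ W ∈ univ.filter (fun W : Fin r → Γ => W i = w),
          wt (univ.image W) * ‖kernel 𝕜 (collapse 𝕜 (Prod.snd : Fin n × Γ → Γ) (U δ : GrassmannAlgebra 𝕜 (Fin n × Γ))) r W‖ := sum_comm
    _ ≤ ∑ δ ∈ Fintype.piFinset (fun _ : Fin n => degs), ∑ _b : Fin n,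
          (if r + 2 * (n - 1) ≤ ∑ a, 2 * δ a then cumulantBound n κ α (lam δ) N r δ else 0) :=
        sum_le_sum fun δ _ => (sum_filter_wt_norm_kernel_collapse_le hwt _ i w).trans (sum_le_sum fun b _ => hδ δ b)
    _ = (n : ℝ) * ∑ δ ∈ Fintype.piFinset (fun _ : Fin n => degs),
          (if r + 2 * (n - 1) ≤ ∑ a, 2 * δ a then cumulantBound n κ α (lam δ) N r δ else 0) := by
        rw [mul_sum]
        exact sum_congr rfl fun δ _ => by rw [sum_const, card_univ, Fintype.card_fin, nsmul_eq_mul]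

/-- (Twin of `sum_wt_norm_kernel_cumulantOf_le_pow` under `IsGramBoundedR`.) **The decay-weighted `‖𝓔ᵀ_C(V; n)‖ ≤ n! Cⁿ ‖V‖_hⁿ` with explicit constants, determinant-bounded covariance** (Benfatto–Giuliani–Mastropietro 2006,
(2.77)–(2.80) with §3 (3.2)–(3.8); Gentile–Mastropietro 2001, §4): for a tree weight `wt`, `V = Σ_{m' ∈ degs} Σ_Y K_{m'}(Y) ψ(Y)`
(degrees `2m'`, `wt`-weighted anchored `L¹` norms `≤ N(m')`), a covariance replica-stably Gram-BOUNDED with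
constant `κ > 0` (`IsGramBoundedR`) and one-copy row and column sums of `‖C(X,Y)‖ wt{X,Y}` at most `α > 0`, and an output field weight
`ρ > 0`: one output label pinned and the others summed against the weight of the output label set,
`Σ_{W : W_i = w} wt(W) ‖kernel_r 𝓔ᵀ_C(V; n) (W)‖ ≤ n! · ρ^{-r} κ^{-2(n-1)} α^{n-1} eⁿ · (Σ_{m'} (e²(κ+ρ))^{2m'} N(m'))ⁿ`.
[cite: BenfattoGiulianiMastropietro2006, (2.77)-(2.80) and §3 (3.2)-(3.8)] -/
theorem sum_wt_norm_kernel_cumulantOf_le_pow_of_gramBounded (hwt : IsTreeWeight wt) {κ : ℝ} (hκ : 0 < κ) (hGB : IsGramBoundedR C κ)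
    (degs : Finset ℕ) (K : (m' : ℕ) → (Fin (2 * m') → Γ) → 𝕜) (N : ℕ → ℝ) (hN0 : ∀ m', 0 ≤ N m')
    (hN : ∀ m' (j : Fin (2 * m')) (w : Γ), ∑ Y ∈ univ.filter (fun Y : Fin (2 * m') → Γ => Y j = w), ‖K m' Y‖ * wt (univ.image Y) ≤ N m')
    {α : ℝ} (hα : 0 < α) (hrow : ∀ X, ∑ Y, ‖C X Y‖ * wt {X, Y} ≤ α) (hcol : ∀ Y, ∑ X, ‖C X Y‖ * wt {X, Y} ≤ α) {ρ : ℝ} (hρ : 0 < ρ)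
    (hn : 0 < n) {r : ℕ} (i : Fin r) (w : Γ) :
    ∑ W ∈ univ.filter (fun W : Fin r → Γ => W i = w), wt (univ.image W) *
        ‖kernel 𝕜 ((cumulantOf (fun k => evenGaussConv 𝕜 C (vertexOf 𝕜 degs K ^ k)) n : evenPart 𝕜 Γ) : GrassmannAlgebra 𝕜 Γ) r W‖ ≤
      (n.factorial : ℝ) * (ρ⁻¹ ^ r * κ⁻¹ ^ (2 * (n - 1)) * (α ^ (n - 1) * Real.exp n)) *
        (∑ m' ∈ degs, (Real.exp 2 * (κ + ρ)) ^ (2 * m') * N m') ^ n :=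
  (sum_wt_norm_kernel_cumulantOf_le_of_gramBounded C hwt hκ.le hGB degs K N hN0 hN hα.le hrow hcol
    (fun δ => (α * ((∑ a, (2 * δ a : ℝ)) + n))⁻¹) (fun δ => by positivity) hn i w).trans
    (mul_sum_ite_cumulantBound_le hκ degs N hN0 hα hρ hn r)

end Literature.MathematicalPhysics.QuantumLattice

end
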